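import Mathlib
import HarnessLib
import Summits.Ventures.LatticeQCDFlow.Exactness.LatticeSitePolynomials

/-!
# Site derivatives on `E^Λ`: the derivative along a fixed vector lowers the polynomial degree, the Euler operator preserves it

HONEST FRAMING: exact (Metropolis-corrected) sampling algorithms for lattice gauge theory;
figures of merit are autocorrelation/cost numbers at stated couplings and volumes; no
continuum-physics claim.

Venture `LatticeQCDFlow` (cell pub-lqcd), topic `Exactness`; FANOUT row 7 (`s0-cpn-null`).  NEW
WORK of the cell over Mathlib and the tree's `Exactness/LatticeSitePolynomials.lean` (`scoord`,
`smonom`, `polyS`); nothing is cited as a fact.  Sphere-model counterpart of theory-1's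
`TrivializingMaps/LinkPolynomials.lean` §2 (`linkDeriv_mem_polyL`); the difference is that E–S's
site operator `∂̃_k·∂̃_k` on the unit spheres, written on the ambient space
(`SphereTangentialLaplacian.laplacian_comp_normalize`: `Δ(f∘ν) = Δf − D²f(x)(x,x) − (d−1)·Df(x) x`
at `‖x‖ = 1`), involves — besides flat second derivatives — the EULER (radial) operator
`Df(x) x`, which does not lower the degree but preserves it.  Printed counterpart, NAMED ONLY:
M. Lüscher, Commun. Math. Phys. 293 (2010) 899, §4.4; Engel–Schaefer, Comput. Phys. Commun. 182
(2011) 2107, §3 (eq. (12), the natural derivative; the display before eq. (15)).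

## Content

* `siteDeriv k v F x = D_k F(x) v` — the derivative at `y = x k` of the site section
  `y ↦ F(x[k ← y])` along a FIXED vector `v`; `siteEuler k F x = D_k F(x) (x k)` — the Euler
  operator of site `k`; Leibniz rules and linearity (`siteDeriv_mul`, `siteDeriv_add`,
  `siteDeriv_smul`, `siteEuler_mul`); `siteDeriv_eq_fderiv_single` (`= DF(x)(δ_k v)`),
  `contDiff_siteDeriv`, `contDiff_siteEuler`.
* `siteDeriv_scoord` (`D_k ⟪b i, x n⟫ v = δ_{nk}⟪b i, v⟫`), `siteEuler_scoord`;
  **`siteDeriv_mem_polyS`**: `siteDeriv k v` maps `polyS N` into `polyS (N − 1)`;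
  **`siteEuler_smonom`** (Euler's identity: a monomial is reproduced times its number of factors at
  site `k`), **`siteEuler_mem_polyS`**: `siteEuler k` maps `polyS N` into itself;
  `siteEuler_eq_sum` (`D_k F(x)(x k) = Σ_i ⟪b i, x k⟫ D_k F(x)(b i)`).

NOT CLAIMED: anything about spheres or measures (ambient calculus only); anything quantitative.
-/

noncomputable section

namespace Summit.Ventures.LatticeQCDFlow.Exactness

open Function Set
open scoped RealInnerProductSpace ContDiff

variable {Λ : Type*} {E : Type*} [NormedAddCommGroup E] [InnerProductSpace ℝ E]

/-! ## §1 The site derivative along a fixed vector and the site Euler operator (ambient calculus) -/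

section SiteCalculus

variable [DecidableEq Λ]

/-- **The site derivative along a fixed vector**: `siteDeriv k v F x = D_k F(x) v`, the derivative
at `y = x k` of the site section `y ↦ F(x[k ← y])`, applied to `v`. -/
def siteDeriv (k : Λ) (v : E) (F : (Λ → E) → ℝ) (x : Λ → E) : ℝ :=
  fderiv ℝ (fun y => F (update x k y)) (x k) v

/-- **The site Euler operator**: `siteEuler k F x = D_k F(x) (x k)` (the radial derivative in the
site-`k` variable). -/
def siteEuler (k : Λ) (F : (Λ → E) → ℝ) (x : Λ → E) : ℝ := siteDeriv k (x k) F x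

/-- **Leibniz rule** for the site derivative (sections differentiable at `x k`). -/
theorem siteDeriv_mul {F G : (Λ → E) → ℝ} {x : Λ → E} {k : Λ} (v : E)
    (hF : DifferentiableAt ℝ (fun y => F (update x k y)) (x k))
    (hG : DifferentiableAt ℝ (fun y => G (update x k y)) (x k)) :
    siteDeriv k v (F * G) x = siteDeriv k v F x * G x + F x * siteDeriv k v G x := by
  unfold siteDeriv
  have e : (fun y => (F * G) (update x k y)) =
      fun y => F (update x k y) * G (update x k y) := rfl
  rw [e, fderiv_fun_mul hF hG, update_eq_self]
  simp only [add_apply, smul_apply, smul_eq_mul]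
  ring

/-- Additivity of the site derivative (sections differentiable at `x k`). -/
theorem siteDeriv_add {F G : (Λ → E) → ℝ} {x : Λ → E} {k : Λ} (v : E)
    (hF : DifferentiableAt ℝ (fun y => F (update x k y)) (x k))
    (hG : DifferentiableAt ℝ (fun y => G (update x k y)) (x k)) :
    siteDeriv k v (F + G) x = siteDeriv k v F x + siteDeriv k v G x := by
  unfold siteDeriv
  have e : (fun y => (F + G) (update x k y)) =
      fun y => F (update x k y) + G (update x k y) := rfl
  rw [e, fderiv_fun_add hF hG]
  simp only [add_apply]

/-- Homogeneity of the site derivative (section differentiable at `x k`). -/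
theorem siteDeriv_smul {F : (Λ → E) → ℝ} {x : Λ → E} {k : Λ} (v : E) (c : ℝ)
    (hF : DifferentiableAt ℝ (fun y => F (update x k y)) (x k)) :
    siteDeriv k v (c • F) x = c * siteDeriv k v F x := by
  unfold siteDeriv
  have e : (fun y => (c • F) (update x k y)) = fun y => c • F (update x k y) := rfl
  rw [e, fderiv_fun_const_smul hF]
  simp only [smul_apply, smul_eq_mul]

/-- The site derivative of a constant vanishes. -/
theorem siteDeriv_const (k : Λ) (v : E) (c : ℝ) : siteDeriv k v (fun _ : Λ → E => c) = 0 := by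
  funext x
  simp only [siteDeriv, fderiv_fun_const, Pi.zero_apply, zero_apply]

/-- The site derivative of the zero functional vanishes. -/
theorem siteDeriv_zero (k : Λ) (v : E) : siteDeriv k v (0 : (Λ → E) → ℝ) = 0 :=
  siteDeriv_const k v 0

/-- The Euler operator of the zero functional vanishes. -/
theorem siteEuler_zero (k : Λ) : siteEuler k (0 : (Λ → E) → ℝ) = 0 := by
  funext x; simp only [siteEuler, siteDeriv_zero, Pi.zero_apply]

/-- **Leibniz rule** for the Euler operator. -/
theorem siteEuler_mul {F G : (Λ → E) → ℝ} {x : Λ → E} {k : Λ}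
    (hF : DifferentiableAt ℝ (fun y => F (update x k y)) (x k))
    (hG : DifferentiableAt ℝ (fun y => G (update x k y)) (x k)) :
    siteEuler k (F * G) x = siteEuler k F x * G x + F x * siteEuler k G x :=
  siteDeriv_mul (x k) hF hG

variable [Fintype Λ]

/-- A smooth functional has differentiable site sections. -/
theorem differentiableAt_section {F : (Λ → E) → ℝ} (hF : ContDiff ℝ ∞ F) (x : Λ → E) (k : Λ)
    (y : E) : DifferentiableAt ℝ (fun y => F (update x k y)) y :=
  ((hF.comp (contDiff_update ∞ x k)).differentiable (by simp)) y

/-- `siteDeriv k v F x = DF(x)(δ_k v)`: the full derivative applied to a direction supported at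
site `k` (for `F` differentiable). -/
theorem siteDeriv_eq_fderiv_single {F : (Λ → E) → ℝ} (hF : ContDiff ℝ ∞ F) (k : Λ) (v : E)
    (x : Λ → E) : siteDeriv k v F x = fderiv ℝ F x (Pi.single k v) := by
  unfold siteDeriv
  rw [fderiv_fun_comp (x k) ((hF.differentiable (by simp)) _)
    (hasFDerivAt_update x (x k)).differentiableAt, update_eq_self, fderiv_update,
    ContinuousLinearMap.comp_apply]
  congr 1
  ext i
  rw [ContinuousLinearMap.pi_apply]
  by_cases hi : i = k
  · subst hi; simp
  · simp [Pi.single_eq_of_ne hi]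

/-- The site derivative of a smooth functional is smooth. -/
theorem contDiff_siteDeriv {F : (Λ → E) → ℝ} (hF : ContDiff ℝ ∞ F) (k : Λ) (v : E) :
    ContDiff ℝ ∞ (siteDeriv k v F) := by
  have e : siteDeriv k v F = fun x => fderiv ℝ F x (Pi.single k v) :=
    funext (siteDeriv_eq_fderiv_single hF k v)
  rw [e]
  exact (hF.fderiv_right (m := ∞) le_rfl).clm_apply contDiff_const

end SiteCalculus

/-! ## §2 Coordinates and monomials under the site operators; stability of `polyS N` -/

section Closure

variable [FiniteDimensional ℝ E] [Fintype Λ] [DecidableEq Λ]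

omit [Fintype Λ] in
/-- The site section of a coordinate at another site is constant; at the same site it is the
coordinate form itself. -/
theorem scoord_update (κ : SiteCoord Λ E) (x : Λ → E) (k : Λ) (y : E) :
    scoord κ (update x k y) =
      if κ.1 = k then ⟪stdOrthonormalBasis ℝ E κ.2, y⟫ else scoord κ x := by
  by_cases h : κ.1 = k
  · rw [if_pos h, scoord, ← h, update_self]
  · rw [if_neg h, scoord, scoord, update_of_ne h]

omit [Fintype Λ] in
/-- **The site derivative of a coordinate is a constant**: `D_k ⟪b i, x n⟫ v = δ_{nk} ⟪b i, v⟫`. -/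
theorem siteDeriv_scoord (k : Λ) (v : E) (κ : SiteCoord Λ E) (x : Λ → E) :
    siteDeriv k v (scoord κ) x = if κ.1 = k then ⟪stdOrthonormalBasis ℝ E κ.2, v⟫ else 0 := by
  unfold siteDeriv
  simp_rw [scoord_update]
  by_cases h : κ.1 = k
  · simp only [if_pos h]
    have e : (fun y : E => ⟪stdOrthonormalBasis ℝ E κ.2, y⟫) =
        ⇑(innerSL ℝ (stdOrthonormalBasis ℝ E κ.2)) := by
      funext y; simp
    rw [e, ContinuousLinearMap.fderiv]
    simp
  · simp only [if_neg h]
    rw [fderiv_fun_const]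
    simp

omit [Fintype Λ] in
/-- **Euler on a coordinate**: `D_k ⟪b i, x n⟫ (x k) = δ_{nk} ⟪b i, x n⟫`. -/
theorem siteEuler_scoord (k : Λ) (κ : SiteCoord Λ E) (x : Λ → E) :
    siteEuler k (scoord κ) x = if κ.1 = k then scoord κ x else 0 := by
  rw [siteEuler, siteDeriv_scoord]
  by_cases h : κ.1 = k
  · rw [if_pos h, if_pos h, scoord, h]
  · rw [if_neg h, if_neg h]

/-- **The site derivative of a degree-`k` monomial is a lattice polynomial of degree `≤ k − 1`**
(Leibniz: each factor at site `n` contributes a constant times the remaining factors). -/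
theorem siteDeriv_smonom_mem (n : Λ) (v : E) :
    ∀ {k : ℕ} (κs : Fin k → SiteCoord Λ E), siteDeriv n v (smonom κs) ∈ polyS Λ E (k - 1)
  | 0, κs => by
      rw [smonom_zero, siteDeriv_const]
      exact Submodule.zero_mem _
  | k + 1, κs => by
      have hprod : siteDeriv n v (smonom κs) =
          siteDeriv n v (scoord (κs 0)) * smonom (Fin.tail κs) +
            scoord (κs 0) * siteDeriv n v (smonom (Fin.tail κs)) := by
        funext x
        rw [smonom_succ]
        exact siteDeriv_mul v (differentiableAt_section (contDiff_scoord _) x n _)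
          (differentiableAt_section (contDiff_smonom _) x n _)
      have hc : siteDeriv n v (scoord (κs 0)) =
          fun _ => if (κs 0).1 = n then ⟪stdOrthonormalBasis ℝ E (κs 0).2, v⟫ else 0 := by
        funext x; exact siteDeriv_scoord n v _ x
      rw [hprod, Nat.add_sub_cancel]
      refine Submodule.add_mem _ ?_ ?_
      · rw [hc]
        exact mul_mem_polyS_of_le (a := 0) (b := k) (by omega) (const_mem_polyS 0 _)
          (smonom_mem le_rfl _)
      · rcases Nat.eq_zero_or_pos k with hk | hk
        · subst hk
          rw [smonom_zero, siteDeriv_const, mul_zero]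
          exact Submodule.zero_mem _
        · exact mul_mem_polyS_of_le (a := 1) (b := k - 1) (by omega) (scoord_mem_polyS le_rfl _)
            (siteDeriv_smonom_mem n v _)

/-- **`siteDeriv k v` maps `polyS N` into `polyS (N − 1)`.** -/
theorem siteDeriv_mem_polyS (k : Λ) (v : E) {N : ℕ} {f : (Λ → E) → ℝ} (hf : f ∈ polyS Λ E N) :
    siteDeriv k v f ∈ polyS Λ E (N - 1) := by
  suffices h : ContDiff ℝ ∞ f ∧ siteDeriv k v f ∈ polyS Λ E (N - 1) from h.2
  induction hf using Submodule.span_induction with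
  | mem x hx =>
      obtain ⟨⟨m, κs⟩, rfl⟩ := hx
      exact ⟨contDiff_smonom κs, polyS_mono (Nat.sub_le_sub_right (Nat.lt_succ_iff.1 m.2) 1)
        (siteDeriv_smonom_mem k v κs)⟩
  | zero =>
      refine ⟨contDiff_const, ?_⟩
      rw [siteDeriv_zero]; exact Submodule.zero_mem _
  | add x y _ _ hx hy =>
      refine ⟨hx.1.add hy.1, ?_⟩
      have : siteDeriv k v (x + y) = siteDeriv k v x + siteDeriv k v y := by
        funext z
        exact siteDeriv_add v (differentiableAt_section hx.1 z k _)
          (differentiableAt_section hy.1 z k _)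
      rw [this]; exact Submodule.add_mem _ hx.2 hy.2
  | smul c x _ hx =>
      refine ⟨hx.1.const_smul c, ?_⟩
      have : siteDeriv k v (c • x) = c • siteDeriv k v x := by
        funext z; rw [Pi.smul_apply, smul_eq_mul]
        exact siteDeriv_smul v c (differentiableAt_section hx.1 z k _)
      rw [this]; exact Submodule.smul_mem _ c hx.2

/-- The site derivative of a member of `polyS N` stays in `polyS N`. -/
theorem siteDeriv_mem_polyS' (k : Λ) (v : E) {N : ℕ} {f : (Λ → E) → ℝ} (hf : f ∈ polyS Λ E N) :
    siteDeriv k v f ∈ polyS Λ E N :=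
  polyS_mono (Nat.sub_le N 1) (siteDeriv_mem_polyS k v hf)

/-- **Euler's identity on a site monomial**: `D_n m(x) (x n) = (#factors at site n) · m(x)` — the
Euler operator reproduces the monomial, times its degree in the site-`n` variables. -/
theorem siteEuler_smonom (n : Λ) :
    ∀ {k : ℕ} (κs : Fin k → SiteCoord Λ E), siteEuler n (smonom κs) =
      fun x => (∑ j, if (κs j).1 = n then (1 : ℝ) else 0) * smonom κs x
  | 0, κs => by
      funext x
      rw [smonom_zero]
      simp only [siteEuler, Finset.univ_eq_empty, Finset.sum_empty, zero_mul]
      exact congrFun (siteDeriv_const n (x n) (1 : ℝ)) x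
  | k + 1, κs => by
      funext x
      have hprod : siteEuler n (smonom κs) x =
          siteEuler n (scoord (κs 0)) x * smonom (Fin.tail κs) x +
            scoord (κs 0) x * siteEuler n (smonom (Fin.tail κs)) x := by
        rw [smonom_succ]
        exact siteEuler_mul (differentiableAt_section (contDiff_scoord _) x n _)
          (differentiableAt_section (contDiff_smonom _) x n _)
      -- the induction hypothesis, read through `Fin.tail κs j = κs j.succ`
      have hih : siteEuler n (smonom (Fin.tail κs)) x =
          (∑ j : Fin k, if (κs j.succ).1 = n then (1 : ℝ) else 0) * smonom (Fin.tail κs) x :=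
        congrFun (siteEuler_smonom n (Fin.tail κs)) x
      rw [hprod, hih, siteEuler_scoord, Fin.sum_univ_succ, congrFun (smonom_succ κs) x]
      split_ifs <;> ring

/-- The Euler operator maps a degree-`k` monomial into `polyS k`. -/
theorem siteEuler_smonom_mem (n : Λ) {k : ℕ} (κs : Fin k → SiteCoord Λ E) :
    siteEuler n (smonom κs) ∈ polyS Λ E k := by
  rw [siteEuler_smonom]
  have e : (fun x => (∑ j, if (κs j).1 = n then (1 : ℝ) else 0) * smonom κs x) =
      (∑ j, if (κs j).1 = n then (1 : ℝ) else 0) • smonom κs := by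
    funext x; simp
  rw [e]
  exact Submodule.smul_mem _ _ (smonom_mem le_rfl κs)

/-- **`siteEuler k` maps `polyS N` into itself.** -/
theorem siteEuler_mem_polyS (k : Λ) {N : ℕ} {f : (Λ → E) → ℝ} (hf : f ∈ polyS Λ E N) :
    siteEuler k f ∈ polyS Λ E N := by
  suffices h : ContDiff ℝ ∞ f ∧ siteEuler k f ∈ polyS Λ E N from h.2
  induction hf using Submodule.span_induction with
  | mem x hx =>
      obtain ⟨⟨m, κs⟩, rfl⟩ := hx
      exact ⟨contDiff_smonom κs, polyS_mono (Nat.lt_succ_iff.1 m.2) (siteEuler_smonom_mem k κs)⟩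
  | zero =>
      refine ⟨contDiff_const, ?_⟩
      rw [siteEuler_zero]; exact Submodule.zero_mem _
  | add x y _ _ hx hy =>
      refine ⟨hx.1.add hy.1, ?_⟩
      have : siteEuler k (x + y) = siteEuler k x + siteEuler k y := by
        funext z
        exact siteDeriv_add (z k) (differentiableAt_section hx.1 z k _)
          (differentiableAt_section hy.1 z k _)
      rw [this]; exact Submodule.add_mem _ hx.2 hy.2
  | smul c x _ hx =>
      refine ⟨hx.1.const_smul c, ?_⟩
      have : siteEuler k (c • x) = c • siteEuler k x := by
        funext z; rw [Pi.smul_apply, smul_eq_mul]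
        exact siteDeriv_smul (z k) c (differentiableAt_section hx.1 z k _)
      rw [this]; exact Submodule.smul_mem _ c hx.2

omit [Fintype Λ] in
/-- The Euler operator in the frame: `D_k F(x)(x k) = Σ_i ⟪b i, x k⟫ · D_k F(x)(b i)`. -/
theorem siteEuler_eq_sum (k : Λ) (F : (Λ → E) → ℝ) (x : Λ → E) :
    siteEuler k F x = ∑ i, scoord ((k, i) : SiteCoord Λ E) x *
      siteDeriv k (stdOrthonormalBasis ℝ E i) F x := by
  unfold siteEuler siteDeriv scoord
  set L := fderiv ℝ (fun y => F (update x k y)) (x k)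
  calc L (x k) = L (∑ i, ⟪stdOrthonormalBasis ℝ E i, x k⟫ • stdOrthonormalBasis ℝ E i) := by
        rw [(stdOrthonormalBasis ℝ E).sum_repr']
    _ = ∑ i, ⟪stdOrthonormalBasis ℝ E i, x k⟫ * L (stdOrthonormalBasis ℝ E i) := by
        simp only [map_sum, map_smul, smul_eq_mul]

/-- The Euler operator of a smooth functional is smooth. -/
theorem contDiff_siteEuler {F : (Λ → E) → ℝ} (hF : ContDiff ℝ ∞ F) (k : Λ) :
    ContDiff ℝ ∞ (siteEuler k F) := by
  have e : siteEuler k F = fun x => ∑ i, scoord ((k, i) : SiteCoord Λ E) x *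
      siteDeriv k (stdOrthonormalBasis ℝ E i) F x := funext (siteEuler_eq_sum k F)
  rw [e]
  exact ContDiff.sum fun i _ => (contDiff_scoord _).mul (contDiff_siteDeriv hF k _)

end Closure

end Summit.Ventures.LatticeQCDFlow.Exactness

end
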